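import Summits.NavierStokesRegularity.NavierStokesRegularity.Theses.AxisymmetricExtremality
import Summits.NavierStokesRegularity.NavierStokesRegularity.Theorems.AxisymmetricExtremalityAxisymmetricKatoGlobalStubSereginLogSwirlOriginLemma21Local
import Summits.NavierStokesRegularity.NavierStokesRegularity.Theorems.AxisymmetricExtremalityAxisymmetricKatoGlobalStubSereginLogSwirlOriginCutoffDivCurl
import HarnessLib

/-!
# Seregin 2022, Lemma 2.1 for the cut-off field `ζv`: `∇(ζv_r/r)` and `∇²(ζv_r/r)` against
# `ζΓ`, `∂₃(ζΓ)` plus explicit error terms living on `supp |∇ζ|` — crux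
# stmt-NavierStokesRegularity-15453 (`AxisymmetricExtremality.AxisymmetricKatoGlobal`), line
# registered, support for stub `stub_sereginLogSwirlOrigin`

Support file (`--supports stmt-NavierStokesRegularity-15453`; theorems only, everything proved)
toward the registered stub `stub_sereginLogSwirlOrigin` = the named fact
`Literature.Analysis.FluidPDE.seregin2022_logSwirl_regularAtOrigin` (G. Seregin, J. Math. Fluid
Mech. 24 (2022), Paper 27 = arXiv:2201.00153, §2). Lemma 2.1 there (arXiv p. 5):

> `‖∇(η³v_r/r)(·,t)‖_{2,𝒞} ≤ c‖η³Γ(·,t)‖_{2,𝒞} + C(v,η)`,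
> `‖∇̄²(η³v_r/r)(·,t)‖_{2,𝒞} ≤ c‖η³Γ,₃(·,t)‖_{2,𝒞} + C(v,η)` (`Γ = ω_θ/r`),

"`f ≠ 0` only if `|∇η| > 0`. In the set `supp |∇η|`, functions `v`, `∇v`, and `∇²v` are
bounded … These terms contain `v₃, v_{r,3}, v_{3,r}, v_{3,rr}, v_{3,r}/r, v_{r,3r}, v_{r,3}/r`."

This file specialises the localised bounds of the sibling file `…Lemma21Local`
(`∫|∇ρ_U|² ≤ ∫Γ_U² − 2∫ρ_U q_{div U}`, `∫|∇²ρ_U|² ≤ ∫(∂₂Γ_U + q_{div U})²`, `U` axisymmetric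
with compact support) to the cut-off field `U = ζv` (`ζ = η³` an axisymmetric compactly
supported scalar, `v` axisymmetric and divergence free on `tsupport ζ`; the swirl component of
`v` enters none of the quantities below, so no poloidal projection `v̄` is needed), through the
three product rules

* `radVelQuot_smul` — `(ζv)_r/r = ζ · (v_r/r)`, i.e. `radVelQuot (ζ • v) = ζ ρ` (`ρ = radVelQuot v`);
* `angVortQuot_smul` — `ω_θ(ζv)/r = ζΓ + ∂₃ζ · (v_r/r) − (∂ᵣζ/r) · v₃`, i.e.
  `angVortQuot (ζ • v) = ζΓ + (∂₂ζ) ρ − q_ζ v₂` (`Γ = angVortQuot v`, `q_ζ = radDerivQuot ζ`;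
  this is `curl(ζv̄) = ζω_θe_θ + ∇ζ × v̄` of the paper, `θ`-component, divided by `r`);
* `divergence_smul_eq_fderiv_apply` — `div (ζv) = ∇ζ · v` (`div v = 0` on `tsupport ζ`),

obtaining (registered sub-goals toward `stub_sereginLogSwirlOrigin`)

* `integral_gradSq_cutoff_radVelQuot_le` —
  `∫|∇(ζρ)|² ≤ ∫(ζΓ + ∂₂ζ ρ − q_ζ v₂)² − 2∫ ζρ · q_{∇ζ·v}` (`ζ, v ∈ C⁴`);
* `integral_hessianSq_cutoff_radVelQuot_le` —
  `∫|∇²(ζρ)|² ≤ ∫(∂₂(ζΓ + ∂₂ζ ρ − q_ζ v₂) + q_{∇ζ·v})²` (`ζ, v ∈ C⁵`),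

with the full Cartesian Hessian on the left, and the split forms
`integral_gradSq_cutoff_radVelQuot_le_two_mul` (`≤ 2∫(ζΓ)² + C²`),
`integral_hessianSq_cutoff_radVelQuot_le_three_mul` (`≤ 3∫(∂₂(ζΓ))² + C²`) with `C²` an explicit
sum of integrals of the error functions. The error functions `∂₂ζ ρ − q_ζ v₂`,
`ζρ · q_{∇ζ·v}` and `q_{∇ζ·v}` vanish off `supp |∇ζ|` and are the paper's `C(v,η)`: they are
polynomial in `ζ`-derivatives and in `ρ = v_r/r`, `v₃`, `(1/r)∂ᵣ(∇ζ·v)` — the listed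
`v₃, v_{r,3}/r, v_{3,r}/r, …` — hence bounded by `sup_{supp ∇ζ} (|v| + |∇v| + |∇²v|)` times
constants of `ζ`.

## Mathlib / tree search

Tree inputs: `integral_gradSq_radVelQuot_le_sub_of_hasCompactSupport`,
`integral_hessianSq_radVelQuot_le_of_hasCompactSupport'` (`…Lemma21Local`);
`IsAxisymmetric.cylRadius_sq_mul_radVelQuot/angVortQuot` (`AxisymHouLiVariables`),
`mul_radDerivQuot_eq_fderiv_zero/one` (`AxisymRadialQuotient`), `eq_of_eq_off_ker`
(`AxisymmetricLiftR5`), `divergence_smul_apply` (`VectorCalculus`), `curl` (definition).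
Mathlib: `fderiv_fun_smul`, `HasCompactSupport.smul_right`, `InnerProductSpace.toDual_symm_apply`.
`lean search 'radVelQuot_smul|angVortQuot_smul|cutoff_radVelQuot'`: no matches (2026-08-17).

## References

* G. Seregin, J. Math. Fluid Mech. 24 (2022), Paper No. 27 = arXiv:2201.00153, §2, Lemma 2.1
  and its proof (arXiv p. 5). [`Seregin2022LocalAxisym`]
* H. Chen, D. Fang, T. Zhang, Discrete Contin. Dyn. Syst. 37 (2017) 1923–1939, Lemma 2.3.
  [`ChenFangZhang2017`]
-/

noncomputable section

open MeasureTheory Set Filter Topology Function InnerProductSpace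
open scoped ENNReal ContDiff
open Literature.Analysis.FluidPDE

-- `<Problem> = <Summit>` duplicates a namespace component by design (lakefile sets the same option).
set_option linter.dupNamespace false

namespace Summit.NavierStokesRegularity.NavierStokesRegularity.Theorems.AxisymmetricKatoGlobal.EulerScaling

variable {ζ : EuclideanSpace ℝ (Fin 3) → ℝ} {v : EuclideanSpace ℝ (Fin 3) → EuclideanSpace ℝ (Fin 3)}

/-! ### The cut-off field `ζv` and its Hou–Li quotients -/

/-- `ζv` is axisymmetric for an axisymmetric scalar `ζ` and an axisymmetric field `v`
(`R_θ` is linear). [folklore] -/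
theorem isAxisymmetric_smul_of_isAxisymmetricScalar (hζax : IsAxisymmetricScalar ζ)
    (hvax : IsAxisymmetric v) : IsAxisymmetric fun y => ζ y • v y := fun θ x => by
  simp only [hζax θ x, hvax θ x]
  exact (map_smul (rotZLIE θ) (ζ x) (v x)).symm

/-- **The swirl of `curl (ζv)`**: `swirl (curl (ζv)) = ζ swirl (curl v) + ∂₂ζ (x₀v₀ + x₁v₁)
− v₂ (x₀∂₀ζ + x₁∂₁ζ)` at every point of differentiability (the `θ`-component of
`curl(ζv) = ζ curl v + ∇ζ × v`, times `r`). [folklore] -/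
theorem swirl_curl_smul {x : EuclideanSpace ℝ (Fin 3)} (hζ : DifferentiableAt ℝ ζ x)
    (hv : DifferentiableAt ℝ v x) :
    swirl (Literature.Analysis.FluidPDE.curl fun y => ζ y • v y) x =
      ζ x * swirl (Literature.Analysis.FluidPDE.curl v) x +
        fderiv ℝ ζ x (EuclideanSpace.single 2 1) * (x 0 * v x 0 + x 1 * v x 1) -
        v x 2 * (x 0 * fderiv ℝ ζ x (EuclideanSpace.single 0 1) +
          x 1 * fderiv ℝ ζ x (EuclideanSpace.single 1 1)) := by
  simp only [swirl, Literature.Analysis.FluidPDE.curl, fderiv_fun_smul hζ hv]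
  simp
  ring

/-- **`(ζv)_r/r = ζ · v_r/r`**: `radVelQuot (ζ • v) = ζ · radVelQuot v` for an axisymmetric
scalar `ζ ∈ C²` and an axisymmetric `v ∈ C²` (off the axis both are `(x₀ζv₀ + x₁ζv₁)/r²`; both
are continuous). [folklore] -/
theorem radVelQuot_smul (hζ : ContDiff ℝ 2 ζ) (hζax : IsAxisymmetricScalar ζ) (hv : ContDiff ℝ 2 v)
    (hvax : IsAxisymmetric v) :
    radVelQuot (fun y => ζ y • v y) = fun x => ζ x * radVelQuot v x := by
  have hw2 : ContDiff ℝ 2 fun y => ζ y • v y := hζ.smul hv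
  have hwax : IsAxisymmetric fun y => ζ y • v y := isAxisymmetric_smul_of_isAxisymmetricScalar hζax hvax
  have hc1 : Continuous (radVelQuot fun y => ζ y • v y) :=
    (contDiff_radVelQuot (n := 0) (by exact_mod_cast hw2)).continuous
  have hc2 : Continuous fun x => ζ x * radVelQuot v x :=
    hζ.continuous.mul (contDiff_radVelQuot (n := 0) (by exact_mod_cast hv)).continuous
  funext x
  refine eq_of_eq_off_ker (EuclideanSpace.proj (0 : Fin 3)) ⟨EuclideanSpace.single 0 1, by simp⟩
    hc1 hc2 (fun z hz => ?_) x
  have hz0 : z 0 ≠ 0 := by simpa using hz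
  have hr : cylRadius z ≠ 0 := fun h => hz0 ((cylRadius_eq_zero_iff z).1 h).1
  have h1 := hwax.cylRadius_sq_mul_radVelQuot hw2 z
  have h2 := hvax.cylRadius_sq_mul_radVelQuot hv z
  simp only [PiLp.smul_apply, smul_eq_mul] at h1
  apply mul_left_cancel₀ (pow_ne_zero 2 hr)
  rw [h1]
  linear_combination -(ζ z) * h2

/-- **`ω_θ(ζv)/r = ζΓ + ∂₃ζ · v_r/r − (∂ᵣζ/r) v₃`**:
`angVortQuot (ζ • v) = ζ · angVortQuot v + (∂₂ζ · radVelQuot v − radDerivQuot ζ · v₂)` for an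
axisymmetric scalar `ζ ∈ C³` and an axisymmetric `v ∈ C³` — the `θ`-component of Seregin's
`curl(ζv̄) = ζω_θe_θ + ∇ζ × v̄` divided by `r` (`swirl_curl_smul`, `x₀∂₀ζ + x₁∂₁ζ = r² q_ζ`,
`x₀v₀ + x₁v₁ = r² ρ`; continuity across the axis). The second summand is supported in
`supp |∇ζ|` and involves only `v_r/r` and `v₃` ("`|v_r/r| ≤ |∇v|`"). [cite: Seregin2022LocalAxisym, §2 Lemma 2.1, proof (arXiv:2201.00153 p. 5: curl(ζv̄) = ζω_θ e_θ + ∇ζ × v̄)] -/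
theorem angVortQuot_smul (hζ : ContDiff ℝ 3 ζ) (hζax : IsAxisymmetricScalar ζ) (hv : ContDiff ℝ 3 v)
    (hvax : IsAxisymmetric v) :
    angVortQuot (fun y => ζ y • v y) = fun x => ζ x * angVortQuot v x +
      (fderiv ℝ ζ x (EuclideanSpace.single 2 1) * radVelQuot v x - radDerivQuot ζ x * v x 2) := by
  have hζ2 : ContDiff ℝ 2 ζ := hζ.of_le (by norm_num)
  have hv2 : ContDiff ℝ 2 v := hv.of_le (by norm_num)
  have hw3 : ContDiff ℝ 3 fun y => ζ y • v y := hζ.smul hv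
  have hwax : IsAxisymmetric fun y => ζ y • v y := isAxisymmetric_smul_of_isAxisymmetricScalar hζax hvax
  have hc1 : Continuous (angVortQuot fun y => ζ y • v y) :=
    (contDiff_angVortQuot (n := 0) (by exact_mod_cast hw3)).continuous
  have hc2 : Continuous fun x => ζ x * angVortQuot v x +
      (fderiv ℝ ζ x (EuclideanSpace.single 2 1) * radVelQuot v x - radDerivQuot ζ x * v x 2) :=
    (hζ.continuous.mul (contDiff_angVortQuot (n := 0) (by exact_mod_cast hv)).continuous).add
      ((((hζ.continuous_fderiv (by norm_num)).clm_apply continuous_const).mul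
        (contDiff_radVelQuot (n := 0) (by exact_mod_cast hv2)).continuous).sub
        ((continuous_radDerivQuot hζ2).mul
          ((contDiff_piLp_apply (𝕜 := ℝ) (p := 2) (n := 0) (i := (2 : Fin 3))).continuous.comp
            hv.continuous)))
  funext x
  refine eq_of_eq_off_ker (EuclideanSpace.proj (0 : Fin 3)) ⟨EuclideanSpace.single 0 1, by simp⟩
    hc1 hc2 (fun z hz => ?_) x
  have hz0 : z 0 ≠ 0 := by simpa using hz
  have hr : cylRadius z ≠ 0 := fun h => hz0 ((cylRadius_eq_zero_iff z).1 h).1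
  have h1 := hwax.cylRadius_sq_mul_angVortQuot hw3 z
  rw [swirl_curl_smul ((hζ.differentiable (by norm_num)) z) ((hv.differentiable (by norm_num)) z)]
    at h1
  have h2 := hvax.cylRadius_sq_mul_angVortQuot hv z
  have h3 := hvax.cylRadius_sq_mul_radVelQuot hv2 z
  have h4 := mul_radDerivQuot_eq_fderiv_zero hζ2 hζax z
  have h5 := mul_radDerivQuot_eq_fderiv_one hζ2 hζax z
  have h6 := cylRadius_sq z
  apply mul_left_cancel₀ (pow_ne_zero 2 hr)
  rw [h1]
  linear_combination (-(ζ z)) * h2 - fderiv ℝ ζ z (EuclideanSpace.single 2 1) * h3 +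
    (v z 2 * z 0) * h4 + (v z 2 * z 1) * h5 + (radDerivQuot ζ z * v z 2) * h6

/-- **`div (ζv) = ∇ζ · v`** when `div v = 0` on `tsupport ζ` (`div(ζv) = ζ div v + ∇ζ·v`;
Seregin: "`div(ζv̄) = v̄·∇ζ`"). [cite: Seregin2022LocalAxisym, §2 Lemma 2.1, proof (arXiv:2201.00153 p. 5: div(ζv̄) = v̄·∇ζ)] -/
theorem divergence_smul_eq_fderiv_apply (hζ : Differentiable ℝ ζ) (hv : Differentiable ℝ v)
    (hdiv : ∀ y ∈ tsupport ζ, VectorCalculus.divergence v y = 0) :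
    VectorCalculus.divergence (fun y => ζ y • v y) = fun x => fderiv ℝ ζ x (v x) := by
  funext x
  rw [divergence_smul_apply (hζ x) (hv x)]
  have h0 : ζ x * VectorCalculus.divergence v x = 0 := by
    by_cases hx : x ∈ tsupport ζ
    · rw [hdiv x hx, mul_zero]
    · rw [image_eq_zero_of_notMem_tsupport hx, zero_mul]
  rw [h0, zero_add, gradient, real_inner_comm, InnerProductSpace.toDual_symm_apply]

/-! ### Lemma 2.1 for `ζv` -/

/-- **Seregin 2022, Lemma 2.1, first estimate, for the cut-off field `ζv`**: for an
axisymmetric scalar `ζ ∈ C⁴` with compact support and an axisymmetric `v ∈ C⁴(ℝ³; ℝ³)` with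
`div v = 0` on `tsupport ζ` (`ρ = radVelQuot v = v_r/r`, `Γ = angVortQuot v = ω_θ/r`,
`q_F = radDerivQuot F = (∂ᵣF)/r`):
`∫ Σᵢ(∂ᵢ(ζρ))² ≤ ∫ (ζΓ + ∂₂ζ ρ − q_ζ v₂)² − 2 ∫ ζρ · q_{∇ζ·v}`.
The leading term is `‖ζΓ‖₂²` (`c = 1`); the functions `∂₂ζ ρ − q_ζ v₂` and `ζρ · q_{∇ζ·v}`
vanish off `supp |∇ζ|` and make up the printed `C(v,η)`. This is
`integral_gradSq_radVelQuot_le_sub_of_hasCompactSupport` for `U = ζ • v` rewritten through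
`radVelQuot_smul`, `angVortQuot_smul`, `divergence_smul_eq_fderiv_apply`. Registered sub-goal
toward `stub_sereginLogSwirlOrigin`. [cite: Seregin2022LocalAxisym, §2 Lemma 2.1, first estimate (arXiv:2201.00153 p. 5)] -/
theorem integral_gradSq_cutoff_radVelQuot_le : ∀ (ζ : EuclideanSpace ℝ (Fin 3) → ℝ) (v : EuclideanSpace ℝ (Fin 3) → EuclideanSpace ℝ (Fin 3)), ContDiff ℝ 4 ζ → HasCompactSupport ζ → IsAxisymmetricScalar ζ → ContDiff ℝ 4 v → IsAxisymmetric v → (∀ y ∈ tsupport ζ, VectorCalculus.divergence v y = 0) → ∫ x, (fderiv ℝ (fun y => ζ y * radVelQuot v y) x (EuclideanSpace.single 0 1) ^ 2 + fderiv ℝ (fun y => ζ y * radVelQuot v y) x (EuclideanSpace.single 1 1) ^ 2 + fderiv ℝ (fun y => ζ y * radVelQuot v y) x (EuclideanSpace.single 2 1) ^ 2) ≤ (∫ x, (ζ x * angVortQuot v x + (fderiv ℝ ζ x (EuclideanSpace.single 2 1) * radVelQuot v x - radDerivQuot ζ x * v x 2)) ^ 2) - 2 * ∫ x, ζ x * radVelQuot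 v x * radDerivQuot (fun y => fderiv ℝ ζ y (v y)) x := by
  intro ζ v hζ hζc hζax hv hvax hdiv
  have h := integral_gradSq_radVelQuot_le_sub_of_hasCompactSupport (fun y => ζ y • v y) (hζ.smul hv)
    hζc.smul_right (isAxisymmetric_smul_of_isAxisymmetricScalar hζax hvax)
  rw [radVelQuot_smul (hζ.of_le (by norm_num)) hζax (hv.of_le (by norm_num)) hvax,
    angVortQuot_smul (hζ.of_le (by norm_num)) hζax (hv.of_le (by norm_num)) hvax,
    divergence_smul_eq_fderiv_apply (hζ.differentiable (by norm_num))
      (hv.differentiable (by norm_num)) hdiv] at h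
  exact h

/-- **Seregin 2022, Lemma 2.1, second estimate, for the cut-off field `ζv`**: for an
axisymmetric scalar `ζ ∈ C⁵` with compact support and an axisymmetric `v ∈ C⁵(ℝ³; ℝ³)` with
`div v = 0` on `tsupport ζ`:
`∫ Σᵢⱼ(∂ⱼ∂ᵢ(ζρ))² ≤ ∫ (∂₂(ζΓ + ∂₂ζ ρ − q_ζ v₂) + q_{∇ζ·v})²` (full Cartesian Hessian on the
left; the leading term on the right is `∂₂(ζΓ) = (ζΓ),₃`, `c = 1`, and `∂₂(∂₂ζ ρ − q_ζ v₂)`,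
`q_{∇ζ·v}` vanish off `supp |∇ζ|` and make up the printed `C(v,η)`). This is
`integral_hessianSq_radVelQuot_le_of_hasCompactSupport'` for `U = ζ • v` rewritten through the
product rules. Registered sub-goal toward `stub_sereginLogSwirlOrigin`. [cite: Seregin2022LocalAxisym, §2 Lemma 2.1, second estimate (arXiv:2201.00153 p. 5)] -/
theorem integral_hessianSq_cutoff_radVelQuot_le : ∀ (ζ : EuclideanSpace ℝ (Fin 3) → ℝ) (v : EuclideanSpace ℝ (Fin 3) → EuclideanSpace ℝ (Fin 3)), ContDiff ℝ 5 ζ → HasCompactSupport ζ → IsAxisymmetricScalar ζ → ContDiff ℝ 5 v → IsAxisymmetric v → (∀ y ∈ tsupport ζ, VectorCalculus.divergence v y = 0) → ∫ x, ∑ i : Fin 3, ∑ j : Fin 3, (fderiv ℝ (fun y => fderiv ℝ (fun z => ζ z * radVelQuot v z) y (EuclideanSpace.single i 1)) x (EuclideanSpace.single j 1)) ^ 2 ≤ ∫ x, (fderiv ℝ (fun y => ζ y * angVortQuot v y + (fderiv ℝ ζ y (EuclideanSpace.single 2 1) * radVelQuot v y - radDerivQuot ζ y * v y 2)) x (EuclideanSpace.single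 2 1) + radDerivQuot (fun y => fderiv ℝ ζ y (v y)) x) ^ 2 := by
  intro ζ v hζ hζc hζax hv hvax hdiv
  have h := integral_hessianSq_radVelQuot_le_of_hasCompactSupport' (fun y => ζ y • v y)
    (hζ.smul hv) hζc.smul_right (isAxisymmetric_smul_of_isAxisymmetricScalar hζax hvax)
  rw [radVelQuot_smul (hζ.of_le (by norm_num)) hζax (hv.of_le (by norm_num)) hvax,
    angVortQuot_smul (hζ.of_le (by norm_num)) hζax (hv.of_le (by norm_num)) hvax,
    divergence_smul_eq_fderiv_apply (hζ.differentiable (by norm_num))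
      (hv.differentiable (by norm_num)) hdiv] at h
  exact h

/-! ### Split forms: `c = 2, 3` times the leading term plus `C(v,η)²` -/

/-- The error function `∂₂ζ ρ − q_ζ v₂` and everything built from `ζ` vanish off `tsupport ζ`:
a continuous real function vanishing off `tsupport ζ`, `ζ` compactly supported, is integrable.
[folklore] -/
theorem integrable_of_eq_zero_off_tsupport (hζc : HasCompactSupport ζ)
    {f : EuclideanSpace ℝ (Fin 3) → ℝ} (hf : Continuous f) (h0 : ∀ x ∉ tsupport ζ, f x = 0) :
    Integrable f :=
  integrable_of_continuous_of_forall_notMem hζc hf h0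

/-- **First estimate, split form**: under the hypotheses of `integral_gradSq_cutoff_radVelQuot_le`,
`∫|∇(ζρ)|² ≤ 2∫(ζΓ)² + (2∫(∂₂ζ ρ − q_ζ v₂)² + 2∫|ζρ · q_{∇ζ·v}|)` — Seregin's
`‖∇(ζv_r/r)‖₂ ≤ c‖ζΓ‖₂ + C(v,η)` with `c² = 2` and `C(v,η)²` the bracket, a sum of integrals over
`tsupport ζ ∩ supp |∇ζ|` of polynomials in `ζ`-derivatives, `v_r/r`, `v₃` and
`(1/r)∂ᵣ(∇ζ·v)`. [cite: Seregin2022LocalAxisym, §2 Lemma 2.1, first estimate (arXiv:2201.00153 p. 5)] -/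
theorem integral_gradSq_cutoff_radVelQuot_le_two_mul (hζ : ContDiff ℝ 4 ζ)
    (hζc : HasCompactSupport ζ) (hζax : IsAxisymmetricScalar ζ) (hv : ContDiff ℝ 4 v)
    (hvax : IsAxisymmetric v) (hdiv : ∀ y ∈ tsupport ζ, VectorCalculus.divergence v y = 0) :
    ∫ x, (fderiv ℝ (fun y => ζ y * radVelQuot v y) x (EuclideanSpace.single 0 1) ^ 2 +
        fderiv ℝ (fun y => ζ y * radVelQuot v y) x (EuclideanSpace.single 1 1) ^ 2 +
        fderiv ℝ (fun y => ζ y * radVelQuot v y) x (EuclideanSpace.single 2 1) ^ 2) ≤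
      2 * (∫ x, (ζ x * angVortQuot v x) ^ 2) +
        (2 * (∫ x, (fderiv ℝ ζ x (EuclideanSpace.single 2 1) * radVelQuot v x -
            radDerivQuot ζ x * v x 2) ^ 2) +
          2 * ∫ x, |ζ x * radVelQuot v x * radDerivQuot (fun y => fderiv ℝ ζ y (v y)) x|) := by
  have h := integral_gradSq_cutoff_radVelQuot_le ζ v hζ hζc hζax hv hvax hdiv
  have hζ2 : ContDiff ℝ 2 ζ := hζ.of_le (by norm_num)
  have hΓ : Continuous (angVortQuot v) :=
    (contDiff_angVortQuot (n := 0) (by exact_mod_cast hv.of_le (by norm_num))).continuous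
  have hρ : Continuous (radVelQuot v) :=
    (contDiff_radVelQuot (n := 0) (by exact_mod_cast hv.of_le (by norm_num))).continuous
  have hdζ : Continuous fun x => fderiv ℝ ζ x (EuclideanSpace.single 2 1) :=
    (hζ.continuous_fderiv (by norm_num)).clm_apply continuous_const
  have hq : Continuous (radDerivQuot ζ) := continuous_radDerivQuot hζ2
  have hv2 : Continuous fun x => v x 2 :=
    (contDiff_piLp_apply (𝕜 := ℝ) (p := 2) (n := 0) (i := (2 : Fin 3))).continuous.comp hv.continuous
  have hD2 : ContDiff ℝ 2 fun y => fderiv ℝ ζ y (v y) :=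
    (hζ.fderiv_right (m := 2) (by norm_num)).clm_apply (hv.of_le (by norm_num))
  have hqD : Continuous (radDerivQuot fun y => fderiv ℝ ζ y (v y)) := continuous_radDerivQuot hD2
  -- vanishing off `tsupport ζ`
  have h0ζ : ∀ x ∉ tsupport ζ, ζ x = 0 := fun x hx => image_eq_zero_of_notMem_tsupport hx
  have h0d : ∀ x ∉ tsupport ζ, fderiv ℝ ζ x (EuclideanSpace.single 2 1) = 0 := fun x hx => by
    rw [fderiv_of_notMem_tsupport ℝ hx]; rfl
  have h0q : ∀ x ∉ tsupport ζ, radDerivQuot ζ x = 0 := fun x hx =>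
    radDerivQuot_eq_zero_of_notMem_tsupport hζ2 hζax hx
  -- integrability
  have hIA : Integrable fun x => (ζ x * angVortQuot v x) ^ 2 :=
    integrable_of_eq_zero_off_tsupport hζc ((hζ.continuous.mul hΓ).pow 2)
      fun x hx => by simp [h0ζ x hx]
  have hIB : Integrable fun x => (fderiv ℝ ζ x (EuclideanSpace.single 2 1) * radVelQuot v x -
      radDerivQuot ζ x * v x 2) ^ 2 :=
    integrable_of_eq_zero_off_tsupport hζc (((hdζ.mul hρ).sub (hq.mul hv2)).pow 2)
      fun x hx => by simp [h0d x hx, h0q x hx]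
  have hIC : Integrable fun x =>
      ζ x * radVelQuot v x * radDerivQuot (fun y => fderiv ℝ ζ y (v y)) x :=
    integrable_of_eq_zero_off_tsupport hζc ((hζ.continuous.mul hρ).mul hqD)
      fun x hx => by simp [h0ζ x hx]
  -- `(a + b)² ≤ 2a² + 2b²` and `−2∫E ≤ 2∫|E|`
  have h1 : ∫ x, (ζ x * angVortQuot v x + (fderiv ℝ ζ x (EuclideanSpace.single 2 1) *
      radVelQuot v x - radDerivQuot ζ x * v x 2)) ^ 2 ≤
      2 * (∫ x, (ζ x * angVortQuot v x) ^ 2) +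
        2 * ∫ x, (fderiv ℝ ζ x (EuclideanSpace.single 2 1) * radVelQuot v x -
          radDerivQuot ζ x * v x 2) ^ 2 := by
    rw [← integral_const_mul, ← integral_const_mul,
      ← integral_add (hIA.const_mul _) (hIB.const_mul _)]
    refine integral_mono_of_nonneg (Eventually.of_forall fun x => sq_nonneg _)
      ((hIA.const_mul _).add (hIB.const_mul _)) (Eventually.of_forall fun x => ?_)
    beta_reduce
    nlinarith [sq_nonneg (ζ x * angVortQuot v x - (fderiv ℝ ζ x (EuclideanSpace.single 2 1) *
      radVelQuot v x - radDerivQuot ζ x * v x 2))]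
  have h2 : -(∫ x, ζ x * radVelQuot v x * radDerivQuot (fun y => fderiv ℝ ζ y (v y)) x) ≤
      ∫ x, |ζ x * radVelQuot v x * radDerivQuot (fun y => fderiv ℝ ζ y (v y)) x| := by
    rw [← integral_neg]
    exact integral_mono hIC.neg hIC.abs fun x => neg_le_abs _
  linarith

/-- **Second estimate, split form**: under the hypotheses of
`integral_hessianSq_cutoff_radVelQuot_le`,
`∫|∇²(ζρ)|² ≤ 3∫(∂₂(ζΓ))² + (3∫(∂₂(∂₂ζ ρ − q_ζ v₂))² + 3∫q_{∇ζ·v}²)` — Seregin's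
`‖∇̄²(ζv_r/r)‖₂ ≤ c‖(ζΓ),₃‖₂ + C(v,η)` with `c² = 3`, the full Cartesian Hessian, and
`C(v,η)²` the bracket (integrals over `tsupport ζ ∩ supp |∇ζ|`). [cite: Seregin2022LocalAxisym, §2 Lemma 2.1, second estimate (arXiv:2201.00153 p. 5)] -/
theorem integral_hessianSq_cutoff_radVelQuot_le_three_mul (hζ : ContDiff ℝ 5 ζ)
    (hζc : HasCompactSupport ζ) (hζax : IsAxisymmetricScalar ζ) (hv : ContDiff ℝ 5 v)
    (hvax : IsAxisymmetric v) (hdiv : ∀ y ∈ tsupport ζ, VectorCalculus.divergence v y = 0) :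
    ∫ x, ∑ i : Fin 3, ∑ j : Fin 3, (fderiv ℝ (fun y =>
        fderiv ℝ (fun z => ζ z * radVelQuot v z) y (EuclideanSpace.single i 1)) x
          (EuclideanSpace.single j 1)) ^ 2 ≤
      3 * (∫ x, fderiv ℝ (fun y => ζ y * angVortQuot v y) x (EuclideanSpace.single 2 1) ^ 2) +
        (3 * (∫ x, fderiv ℝ (fun y => fderiv ℝ ζ y (EuclideanSpace.single 2 1) * radVelQuot v y -
            radDerivQuot ζ y * v y 2) x (EuclideanSpace.single 2 1) ^ 2) +
          3 * ∫ x, radDerivQuot (fun y => fderiv ℝ ζ y (v y)) x ^ 2) := by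
  have h := integral_hessianSq_cutoff_radVelQuot_le ζ v hζ hζc hζax hv hvax hdiv
  have hζ2 : ContDiff ℝ 2 ζ := hζ.of_le (by norm_num)
  -- the three functions `A = ζΓ`, `B = ∂₂ζ ρ − q_ζ v₂`, `D = ∇ζ·v` are `C¹` and vanish off
  -- `tsupport ζ`
  have hA1 : ContDiff ℝ 1 fun y => ζ y * angVortQuot v y := (hζ.of_le (by norm_num)).mul
    (contDiff_angVortQuot (n := 1) (by exact_mod_cast hv.of_le (by norm_num)))
  have hB1 : ContDiff ℝ 1 fun y => fderiv ℝ ζ y (EuclideanSpace.single 2 1) * radVelQuot v y -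
      radDerivQuot ζ y * v y 2 :=
    (((hζ.fderiv_right (m := 1) (by norm_num)).clm_apply contDiff_const).mul
      (contDiff_radVelQuot (n := 1) (by exact_mod_cast hv.of_le (by norm_num)))).sub
      ((contDiff_radDerivQuot (n := 1) (by exact_mod_cast hζ.of_le (by norm_num))).mul
        ((contDiff_piLp_apply (𝕜 := ℝ) (p := 2) (n := 1) (i := (2 : Fin 3))).comp
          (hv.of_le (by norm_num))))
  have hD2 : ContDiff ℝ 2 fun y => fderiv ℝ ζ y (v y) :=
    (hζ.fderiv_right (m := 2) (by norm_num)).clm_apply (hv.of_le (by norm_num))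
  have hDax : IsAxisymmetricScalar fun y => fderiv ℝ ζ y (v y) := fun θ y => by
    simp only [hvax θ y]
    exact hζax.fderiv_rotZ_apply_rotZ (hζ.differentiable (by norm_num)) θ y (v y)
  have h0A : ∀ x ∉ tsupport ζ, ζ x * angVortQuot v x = 0 := fun x hx => by
    rw [image_eq_zero_of_notMem_tsupport hx, zero_mul]
  have h0B : ∀ x ∉ tsupport ζ, fderiv ℝ ζ x (EuclideanSpace.single 2 1) * radVelQuot v x -
      radDerivQuot ζ x * v x 2 = 0 := fun x hx => by
    rw [fderiv_of_notMem_tsupport ℝ hx, radDerivQuot_eq_zero_of_notMem_tsupport hζ2 hζax hx]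
    simp
  have h0D : ∀ x ∉ tsupport ζ, fderiv ℝ ζ x (v x) = 0 := fun x hx => by
    rw [fderiv_of_notMem_tsupport ℝ hx]; rfl
  have hDsub : tsupport (fun y => fderiv ℝ ζ y (v y)) ⊆ tsupport ζ :=
    closure_minimal (fun y hy => by_contra fun h' => hy (h0D y h')) (isClosed_tsupport ζ)
  -- so `∂₂A`, `∂₂B`, `q_D` are continuous, vanish off `tsupport ζ`, and are square integrable
  have hcA : Continuous fun x => fderiv ℝ (fun y => ζ y * angVortQuot v y) x
      (EuclideanSpace.single 2 1) := (hA1.continuous_fderiv one_ne_zero).clm_apply continuous_const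
  have hcB : Continuous fun x => fderiv ℝ (fun y => fderiv ℝ ζ y (EuclideanSpace.single 2 1) *
      radVelQuot v y - radDerivQuot ζ y * v y 2) x (EuclideanSpace.single 2 1) :=
    (hB1.continuous_fderiv one_ne_zero).clm_apply continuous_const
  have hcD : Continuous (radDerivQuot fun y => fderiv ℝ ζ y (v y)) := continuous_radDerivQuot hD2
  have hIA : Integrable fun x => fderiv ℝ (fun y => ζ y * angVortQuot v y) x
      (EuclideanSpace.single 2 1) ^ 2 :=
    integrable_of_eq_zero_off_tsupport hζc (hcA.pow 2) fun x hx => by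
      simp [fderiv_eq_zero_of_forall_notMem (isClosed_tsupport ζ) h0A hx]
  have hIB : Integrable fun x => fderiv ℝ (fun y => fderiv ℝ ζ y (EuclideanSpace.single 2 1) *
      radVelQuot v y - radDerivQuot ζ y * v y 2) x (EuclideanSpace.single 2 1) ^ 2 :=
    integrable_of_eq_zero_off_tsupport hζc (hcB.pow 2) fun x hx => by
      simp [fderiv_eq_zero_of_forall_notMem (isClosed_tsupport ζ) h0B hx]
  have hID : Integrable fun x => radDerivQuot (fun y => fderiv ℝ ζ y (v y)) x ^ 2 :=
    integrable_of_eq_zero_off_tsupport hζc (hcD.pow 2) fun x hx => by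
      simp [radDerivQuot_eq_zero_of_notMem_tsupport hD2 hDax fun h' => hx (hDsub h')]
  -- `∂₂(A + B) = ∂₂A + ∂₂B` and `(a + b + c)² ≤ 3a² + 3b² + 3c²`
  have hsplit : ∀ x, fderiv ℝ (fun y => ζ y * angVortQuot v y +
      (fderiv ℝ ζ y (EuclideanSpace.single 2 1) * radVelQuot v y - radDerivQuot ζ y * v y 2)) x
      (EuclideanSpace.single 2 1) =
      fderiv ℝ (fun y => ζ y * angVortQuot v y) x (EuclideanSpace.single 2 1) +
        fderiv ℝ (fun y => fderiv ℝ ζ y (EuclideanSpace.single 2 1) * radVelQuot v y -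
          radDerivQuot ζ y * v y 2) x (EuclideanSpace.single 2 1) := fun x => by
    rw [fderiv_fun_add ((hA1.differentiable one_ne_zero) x) ((hB1.differentiable one_ne_zero) x)]
    rfl
  have hIBD : Integrable fun x => 3 * fderiv ℝ (fun y => fderiv ℝ ζ y (EuclideanSpace.single 2 1) *
      radVelQuot v y - radDerivQuot ζ y * v y 2) x (EuclideanSpace.single 2 1) ^ 2 +
      3 * radDerivQuot (fun y => fderiv ℝ ζ y (v y)) x ^ 2 := (hIB.const_mul 3).add (hID.const_mul 3)
  have hIABD : Integrable fun x => 3 * fderiv ℝ (fun y => ζ y * angVortQuot v y) x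
      (EuclideanSpace.single 2 1) ^ 2 + (3 * fderiv ℝ (fun y =>
        fderiv ℝ ζ y (EuclideanSpace.single 2 1) * radVelQuot v y - radDerivQuot ζ y * v y 2) x
        (EuclideanSpace.single 2 1) ^ 2 + 3 * radDerivQuot (fun y => fderiv ℝ ζ y (v y)) x ^ 2) :=
    (hIA.const_mul 3).add hIBD
  refine h.trans ?_
  rw [← integral_const_mul, ← integral_const_mul, ← integral_const_mul,
    ← integral_add (hIB.const_mul _) (hID.const_mul _), ← integral_add (hIA.const_mul _) hIBD]
  refine integral_mono_of_nonneg (Eventually.of_forall fun x => sq_nonneg _) hIABD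
    (Eventually.of_forall fun x => ?_)
  beta_reduce
  rw [hsplit x]
  nlinarith [sq_nonneg (fderiv ℝ (fun y => ζ y * angVortQuot v y) x (EuclideanSpace.single 2 1) -
      fderiv ℝ (fun y => fderiv ℝ ζ y (EuclideanSpace.single 2 1) * radVelQuot v y -
        radDerivQuot ζ y * v y 2) x (EuclideanSpace.single 2 1)),
    sq_nonneg (fderiv ℝ (fun y => ζ y * angVortQuot v y) x (EuclideanSpace.single 2 1) -
      radDerivQuot (fun y => fderiv ℝ ζ y (v y)) x),
    sq_nonneg (fderiv ℝ (fun y => fderiv ℝ ζ y (EuclideanSpace.single 2 1) * radVelQuot v y -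
        radDerivQuot ζ y * v y 2) x (EuclideanSpace.single 2 1) -
      radDerivQuot (fun y => fderiv ℝ ζ y (v y)) x)]

end Summit.NavierStokesRegularity.NavierStokesRegularity.Theorems.AxisymmetricKatoGlobal.EulerScaling

end
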